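import Summits.QuantumFields.YangMills.Theorems.BalabanUVNodesN15PerCubeGreenFineRows
import HarnessLib

/-!
# N15 = NE2, road (c) — PROGRAMME (PC), FILE B2: THE CUT ROWS OF THE COMPRESSED TORUS GREEN's FUNCTION on the coloured site carrier — 52's [hcut] [hcutF] [hcutB]
# from dag-n15-a's flat rows `G′(1)`, `∂G′(1)`, `S̄ₕ∂G′(1)` (Ξ-4 `flatRowsAll_king`) by a carrier pull-back `∇_μ∘G = (∂G)|_μ`, `∇⁻_μ∘G = (S̄ₕ∂G)|_μ` (dag-n15-c g26, n15-c∕261b′ = the FINE-GRID twin of n15-c∕261b at spacing `L^{−r}L^{−k}`)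

Cell `pub-ymgap`, seat `pub-ymgap-dag-n15-c` (generation g26; R134 (a), s1; HUMAN RULING D-0062; chair R424 venue).  `bears_on: R4∕N15 · K3⁸ SpineGivenEndpointR13SepCoPHV
(stmt-QuantumFields-27366)`; filed `--supports stmt-QuantumFields-27366 --as helper` — COUNT-NEUTRAL.  Theorems only; 0 `sorry`.  Imports BY NAME n15-c∕261′ `…PerCubeGreenFineRows`
(`hasMaj_comp_mulOp_cut`, `hasMaj_mulOp_cut_comp`, `hasMaj_pullCarrier_comp`; through it n15-c∕260 objects, n15-c∕197 `cgrad`∕`cGreen`, dag-n15-a `bBack`).  Nothing in the tree is modified.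

WHAT.  `fgrad_comp_mulVecLin_eq_pull'` ∕ `bgrad_comp_mulVecLin_eq_pull'` (the forward ∕ backward quotient of a site operator along `e_μ` IS the `μ`-component of dag-n15-a's bond-valued `D_1G`,
resp. `S̄ₕD_1G`, pulled back to sites), ★★ `hasMaj_cut_scCube'` ∕ `hasMaj_cutF_scCube'` ∕ `hasMaj_cutB_scCube'`: `M_{χ_k}∘(G′(1)∘M_{ψ_k})`, `M_{χ_k}∘∇_μ∘(…)`, `M_{χ_k}∘∇⁻_μ∘(…)` are
`≤ 1_□1_□·C·e^{−δ|y−y′|_T}` given the flat rows `G′(1)`, `∂G′(1)`, `S̄ₕ∂G′(1) ≤ Ce^{−δ|y−y′|_T}` (supplied HYPOTHESIS-FREE by Ξ-4 in the knit, FILE C).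

HONEST FRAMING ∕ LIMITS.  Finite-dimensional bookkeeping over displayed rows on MODEL carriers; [B9] Thm 3.1 (3.42) p.397 (entries 0–1 at `U ≡ 1`), (3.87) p.409 = SHAPES, nothing of
[B5]∕[B6]∕[B9] asserted.  NE2⁺ NOT PRINTED, NOT proved; N15 of record untouched (DISCHARGED AS CONSUMED, p687738); K3⁸ OPEN; counts of record UNMOVED (typed 28∕28 · discharged
8∕27); one finite 𝕋⁴ at fixed ε per index — NOT infinite volume, NOT OS on ℝ⁴, NOT a mass gap, NOT Clay.  Restate-immune (no Theses import).
-/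

noncomputable section

open scoped BigOperators Matrix

namespace Summit.QuantumFields.YangMills.BalabanUVNodes.N15.Gluing

open Real
open Literature.MathematicalPhysics.QuantumFieldTheory.Balaban1983to89
open Literature.MathematicalPhysics.QuantumFieldTheory.Balaban1983to89.B5Prop11Plancherel (Tor fine unitVec)
open Literature.MathematicalPhysics.QuantumFieldTheory.Balaban1983to89.B11SectG (BlockNorm HasMaj)
open Literature.MathematicalPhysics.QuantumFieldTheory.Balaban1983to89.B6Prop26Gluing (mulOp mulOp_apply ind ind_nonneg)
open Literature.MathematicalPhysics.QuantumFieldTheory.Balaban1983to89.B6UnitTorusCarrier (unitTorusGeo)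
open Literature.MathematicalPhysics.QuantumFieldTheory.Balaban1983to89.T4EtaRateCoeffDefect (pull pull_apply)
open Literature.MathematicalPhysics.QuantumFieldTheory.King1986.Torus (blockOf tdistT tdistT_nonneg)
open Summit.QuantumFields.YangMills.BalabanUVNodes.N15.BackgroundLayer (fgrad bgrad fgrad_apply bgrad_apply)
open Summit.QuantumFields.YangMills.BalabanUVNodes.N15.MatrixSpecies (liftBlk liftEquiv liftEquiv_apply liftEquiv_symm_apply)
open Summit.QuantumFields.YangMills.BalabanUVNodes.N15.TwoGrid (chiCube cubeBlocks chiCube_of_not_mem abs_chiCube_le_one)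
open Summit.QuantumFields.YangMills.BalabanUVNodes.N15.CovLandau (cgrad cGreen cgrad_mulVec bBack bBack_mulVec)

variable {d : ℕ}

/-! ## §5 The cut rows of the compressed torus Green's function from the flat rows by a carrier pull-back -/

section CutRows

variable {L : ℕ} [NeZero L] {mv kk r : ℕ} {hL : Odd L ∧ 1 < L} (ι : Type) [Fintype ι] [DecidableEq ι]

/-- `∇_μ∘mulVecLin G = (∂G)|_μ`: the forward quotient of a site operator along `e_μ` IS the `μ`-component of dag-n15-a's bond-valued `D_1 G`, pulled back to sites. [folklore] -/
theorem fgrad_comp_mulVecLin_eq_pull' (μ : Fin (d + 1)) (G : Matrix (ScX' d L mv kk r hL × ι) (ScX' d L mv kk r hL × ι) ℝ) :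
    fgrad (((L ^ r * L ^ kk : ℕ) : ℝ)) (liftEquiv (scShift' d L mv kk r hL μ) ι) ∘ₗ Matrix.mulVecLin G =
      pull (fun p : ScX' d L mv kk r hL × ι => ((p.1, μ), p.2)) ∘ₗ
        Matrix.mulVecLin (cgrad (cvM d L mv kk hL) (L ^ r * L ^ kk) (fun (_ : Fin (d + 1)) (_ : ScX' d L mv kk r hL) => (1 : Matrix ι ι ℝ)) * G) := by
  classical
  refine LinearMap.ext fun f => funext fun p => ?_
  rw [LinearMap.comp_apply, LinearMap.comp_apply, pull_apply, Matrix.mulVecLin_apply, Matrix.mulVecLin_apply, ← Matrix.mulVec_mulVec, cgrad_mulVec, fgrad_apply]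
  simp only [liftEquiv_apply, Equiv.coe_addRight, Matrix.one_apply, ite_mul, one_mul, zero_mul, Finset.sum_ite_eq, Finset.mem_univ, if_true]

/-- `∇⁻_μ∘mulVecLin G = (S̄ₕ∂G)|_μ`: the backward quotient IS the `μ`-component of the back-shifted bond-valued `S̄ₕD_1 G`, pulled back to sites (dag-n15-a `bBack`). [folklore] -/
theorem bgrad_comp_mulVecLin_eq_pull' (μ : Fin (d + 1)) (G : Matrix (ScX' d L mv kk r hL × ι) (ScX' d L mv kk r hL × ι) ℝ) :
    bgrad (((L ^ r * L ^ kk : ℕ) : ℝ)) (liftEquiv (scShift' d L mv kk r hL μ) ι) ∘ₗ Matrix.mulVecLin G =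
      pull (fun p : ScX' d L mv kk r hL × ι => ((p.1, μ), p.2)) ∘ₗ
        Matrix.mulVecLin (bBack (cvM d L mv kk hL) (L ^ r * L ^ kk) (ι := ι) * (cgrad (cvM d L mv kk hL) (L ^ r * L ^ kk) (fun (_ : Fin (d + 1)) (_ : ScX' d L mv kk r hL) => (1 : Matrix ι ι ℝ)) * G)) := by
  classical
  refine LinearMap.ext fun f => funext fun p => ?_
  rw [LinearMap.comp_apply, LinearMap.comp_apply, pull_apply, Matrix.mulVecLin_apply, Matrix.mulVecLin_apply, ← Matrix.mulVec_mulVec, bBack_mulVec, ← Matrix.mulVec_mulVec,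
    cgrad_mulVec, bgrad_apply]
  simp only [liftEquiv_symm_apply, Equiv.addRight_symm, Equiv.coe_addRight, Matrix.one_apply, ite_mul, one_mul, zero_mul, Finset.sum_ite_eq, Finset.mem_univ, if_true,
    ← sub_eq_add_neg, sub_add_cancel]

variable (hM : ∀ ν, cvM d L mv kk hL ν = 2 * L * L ^ mv) (hm₁ : 2 * L ^ mv ≤ coverMargin L mv) (hfitI : coverMargin L mv - 2 * L ^ mv + (6 * L ^ mv + 1) ≤ L * L ^ mv)
  (hS0 : L * L ^ mv ≤ 2 * L * L ^ mv)
include hM hm₁ hfitI hS0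

/-- ★★ **52's [hcut] FOR THE COMPRESSED TORUS GREEN's FUNCTION**: `M_{χ_k}∘(G′(1)∘M_{ψ_k}) ≤ 1_□1_□·C·e^{−δ|y−y′|_T}` from the flat row `G′(1) ≤ Ce^{−δ|y−y′|_T}` (Ξ-4 r1).
[cite: Balaban1985BackgroundPropagators, (3.87) p.409, Thm 3.1 (3.42) p.397 (entry 0 at `U ≡ 1`: shape)] -/
theorem hasMaj_cut_scCube' {a C δ : ℝ} (hC : 0 ≤ C)
    (hG : HasMaj (ScNorm' d L mv kk r hL ι) (ScNorm' d L mv kk r hL ι) (Matrix.mulVecLin (cGreen (cvM d L mv kk hL) (L ^ r * L ^ kk) (fun (_ : Fin (d + 1)) (_ : ScX' d L mv kk r hL) => (1 : Matrix ι ι ℝ)) a))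
      (fun y y' => C * Real.exp (-(δ * tdistT (cvM d L mv kk hL) y y')))) (k : Fin (d + 1) → ZMod (2 * L)) :
    HasMaj (ScNorm' d L mv kk r hL ι) (ScNorm' d L mv kk r hL ι) (mulOp (fun p : ScX' d L mv kk r hL × ι => scChi' d L mv kk r hL k p.1) ∘ₗ scCube' d L mv kk r hL a ι k)
      (fun y y' => ind (cvSk d L mv kk hL k) y * ind (cvSk d L mv kk hL k) y' * (C * Real.exp (-(δ * (unitTorusGeo L kk (cvM d L mv kk hL)).dist y y')))) := by
  have h1 := hasMaj_comp_mulOp_cut (b₂ := ScNorm' d L mv kk r hL ι) (liftBlk (scBlk' d L mv kk r hL) ι) (fun y y' => by positivity) (S := cvSk d L mv kk hL k)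
    (χ := fun p : ScX' d L mv kk r hL × ι => scPsi' d L mv kk r hL k p.1) (fun p => abs_chiCube_le_one _ _) (fun p hp => Finset.mem_coe.mpr (by by_contra h; exact hp (chiCube_of_not_mem h))) hG
  have h2 := hasMaj_mulOp_cut_comp (b₁ := ScNorm' d L mv kk r hL ι) (liftBlk (scBlk' d L mv kk r hL) ι) (fun y y' => mul_nonneg (ind_nonneg _ _) (by positivity)) (S := cvSk d L mv kk hL k)
    (χ := fun p : ScX' d L mv kk r hL × ι => scChi' d L mv kk r hL k p.1) (fun p => abs_chiCube_le_one _ _)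
    (fun p hp => Finset.mem_coe.mpr (blockOf_mem_cubeBlocks_of_inner_ne_zero hM hm₁ hfitI hS0 hp)) h1
  rw [scCube']
  exact h2.mono fun y y' => le_of_eq (by ring)

/-- ★★ **52's [hcutF]**: `M_{χ_k}∘∇_μ∘(G′(1)∘M_{ψ_k}) ≤ 1_□1_□·C·e^{−δ|y−y′|_T}` from the flat row `∂G′(1) ≤ Ce^{−δ|y−y′|_T}` (Ξ-4 r2), read on sites by `fgrad_comp_mulVecLin_eq_pull'`.
[cite: Balaban1985BackgroundPropagators, Thm 3.1 (3.42) p.397 (entry 1 at `U ≡ 1`: shape), (3.87) p.409] -/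
theorem hasMaj_cutF_scCube' {a C δ : ℝ} (hC : 0 < C) (μ : Fin (d + 1))
    (hD : HasMaj (ScNorm' d L mv kk r hL ι) (BlockNorm.ofBlocks (unitTorusGeo L kk (cvM d L mv kk hL)) (liftBlk (fun b : ScX' d L mv kk r hL × Fin (d + 1) => blockOf (L ^ r * L ^ kk) (cvM d L mv kk hL) b.1) ι))
      (Matrix.mulVecLin (cgrad (cvM d L mv kk hL) (L ^ r * L ^ kk) (fun (_ : Fin (d + 1)) (_ : ScX' d L mv kk r hL) => (1 : Matrix ι ι ℝ)) *
        cGreen (cvM d L mv kk hL) (L ^ r * L ^ kk) (fun (_ : Fin (d + 1)) (_ : ScX' d L mv kk r hL) => (1 : Matrix ι ι ℝ)) a)) (fun y y' => C * Real.exp (-(δ * tdistT (cvM d L mv kk hL) y y'))))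
    (k : Fin (d + 1) → ZMod (2 * L)) :
    HasMaj (ScNorm' d L mv kk r hL ι) (ScNorm' d L mv kk r hL ι)
      (mulOp (fun p : ScX' d L mv kk r hL × ι => scChi' d L mv kk r hL k p.1) ∘ₗ (fgrad ((((L ^ r * L ^ kk : ℕ) : ℝ))⁻¹)⁻¹ (liftEquiv (scShift' d L mv kk r hL μ) ι) ∘ₗ scCube' d L mv kk r hL a ι k))
      (fun y y' => ind (cvSk d L mv kk hL k) y * ind (cvSk d L mv kk hL k) y' * (C * Real.exp (-(δ * (unitTorusGeo L kk (cvM d L mv kk hL)).dist y y')))) := by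
  have hGF : HasMaj (ScNorm' d L mv kk r hL ι) (ScNorm' d L mv kk r hL ι)
      (fgrad (((L ^ r * L ^ kk : ℕ) : ℝ)) (liftEquiv (scShift' d L mv kk r hL μ) ι) ∘ₗ Matrix.mulVecLin (cGreen (cvM d L mv kk hL) (L ^ r * L ^ kk) (fun (_ : Fin (d + 1)) (_ : ScX' d L mv kk r hL) => (1 : Matrix ι ι ℝ)) a))
      (fun y y' => C * Real.exp (-(δ * tdistT (cvM d L mv kk hL) y y'))) := by
    rw [fgrad_comp_mulVecLin_eq_pull']
    exact hasMaj_pullCarrier_comp (g := unitTorusGeo L kk (cvM d L mv kk hL)) (liftBlk (fun b : ScX' d L mv kk r hL × Fin (d + 1) => blockOf (L ^ r * L ^ kk) (cvM d L mv kk hL) b.1) ι) (liftBlk (scBlk' d L mv kk r hL) ι)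
      (fun p : ScX' d L mv kk r hL × ι => ((p.1, μ), p.2)) (fun _ => rfl) (fun y y' => mul_nonneg hC.le (Real.exp_nonneg _)) hD
  have h1 := hasMaj_comp_mulOp_cut (b₂ := ScNorm' d L mv kk r hL ι) (liftBlk (scBlk' d L mv kk r hL) ι) (fun y y' => by positivity) (S := cvSk d L mv kk hL k)
    (χ := fun p : ScX' d L mv kk r hL × ι => scPsi' d L mv kk r hL k p.1) (fun p => abs_chiCube_le_one _ _) (fun p hp => Finset.mem_coe.mpr (by by_contra h; exact hp (chiCube_of_not_mem h))) hGF
  have h2 := hasMaj_mulOp_cut_comp (b₁ := ScNorm' d L mv kk r hL ι) (liftBlk (scBlk' d L mv kk r hL) ι) (fun y y' => mul_nonneg (ind_nonneg _ _) (by positivity)) (S := cvSk d L mv kk hL k)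
    (χ := fun p : ScX' d L mv kk r hL × ι => scChi' d L mv kk r hL k p.1) (fun p => abs_chiCube_le_one _ _)
    (fun p hp => Finset.mem_coe.mpr (blockOf_mem_cubeBlocks_of_inner_ne_zero hM hm₁ hfitI hS0 hp)) h1
  rw [inv_inv, scCube', ← LinearMap.comp_assoc (mulOp fun p : ScX' d L mv kk r hL × ι => scPsi' d L mv kk r hL k p.1)]
  exact h2.mono fun y y' => le_of_eq (by ring)

/-- ★★ **52's [hcutB]**: `M_{χ_k}∘∇⁻_μ∘(G′(1)∘M_{ψ_k}) ≤ 1_□1_□·C·e^{−δ|y−y′|_T}` from the flat row `S̄ₕ∂G′(1) ≤ Ce^{−δ|y−y′|_T}` (Ξ-4 r4), read on sites by `bgrad_comp_mulVecLin_eq_pull'`.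
[cite: Balaban1985BackgroundPropagators, Thm 3.1 (3.42) p.397 (entry 1 at `U ≡ 1`: shape), (3.87) p.409; Balaban1984PropagatorsI, (1.3) p.18] -/
theorem hasMaj_cutB_scCube' {a C δ : ℝ} (hC : 0 < C) (μ : Fin (d + 1))
    (hB : HasMaj (ScNorm' d L mv kk r hL ι) (BlockNorm.ofBlocks (unitTorusGeo L kk (cvM d L mv kk hL)) (liftBlk (fun b : ScX' d L mv kk r hL × Fin (d + 1) => blockOf (L ^ r * L ^ kk) (cvM d L mv kk hL) b.1) ι))
      (Matrix.mulVecLin (bBack (cvM d L mv kk hL) (L ^ r * L ^ kk) (ι := ι) * (cgrad (cvM d L mv kk hL) (L ^ r * L ^ kk) (fun (_ : Fin (d + 1)) (_ : ScX' d L mv kk r hL) => (1 : Matrix ι ι ℝ)) *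
        cGreen (cvM d L mv kk hL) (L ^ r * L ^ kk) (fun (_ : Fin (d + 1)) (_ : ScX' d L mv kk r hL) => (1 : Matrix ι ι ℝ)) a))) (fun y y' => C * Real.exp (-(δ * tdistT (cvM d L mv kk hL) y y'))))
    (k : Fin (d + 1) → ZMod (2 * L)) :
    HasMaj (ScNorm' d L mv kk r hL ι) (ScNorm' d L mv kk r hL ι)
      (mulOp (fun p : ScX' d L mv kk r hL × ι => scChi' d L mv kk r hL k p.1) ∘ₗ (bgrad ((((L ^ r * L ^ kk : ℕ) : ℝ))⁻¹)⁻¹ (liftEquiv (scShift' d L mv kk r hL μ) ι) ∘ₗ scCube' d L mv kk r hL a ι k))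
      (fun y y' => ind (cvSk d L mv kk hL k) y * ind (cvSk d L mv kk hL k) y' * (C * Real.exp (-(δ * (unitTorusGeo L kk (cvM d L mv kk hL)).dist y y')))) := by
  have hGB : HasMaj (ScNorm' d L mv kk r hL ι) (ScNorm' d L mv kk r hL ι)
      (bgrad (((L ^ r * L ^ kk : ℕ) : ℝ)) (liftEquiv (scShift' d L mv kk r hL μ) ι) ∘ₗ Matrix.mulVecLin (cGreen (cvM d L mv kk hL) (L ^ r * L ^ kk) (fun (_ : Fin (d + 1)) (_ : ScX' d L mv kk r hL) => (1 : Matrix ι ι ℝ)) a))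
      (fun y y' => C * Real.exp (-(δ * tdistT (cvM d L mv kk hL) y y'))) := by
    rw [bgrad_comp_mulVecLin_eq_pull']
    exact hasMaj_pullCarrier_comp (g := unitTorusGeo L kk (cvM d L mv kk hL)) (liftBlk (fun b : ScX' d L mv kk r hL × Fin (d + 1) => blockOf (L ^ r * L ^ kk) (cvM d L mv kk hL) b.1) ι) (liftBlk (scBlk' d L mv kk r hL) ι)
      (fun p : ScX' d L mv kk r hL × ι => ((p.1, μ), p.2)) (fun _ => rfl) (fun y y' => mul_nonneg hC.le (Real.exp_nonneg _)) hB
  have h1 := hasMaj_comp_mulOp_cut (b₂ := ScNorm' d L mv kk r hL ι) (liftBlk (scBlk' d L mv kk r hL) ι) (fun y y' => by positivity) (S := cvSk d L mv kk hL k)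
    (χ := fun p : ScX' d L mv kk r hL × ι => scPsi' d L mv kk r hL k p.1) (fun p => abs_chiCube_le_one _ _) (fun p hp => Finset.mem_coe.mpr (by by_contra h; exact hp (chiCube_of_not_mem h))) hGB
  have h2 := hasMaj_mulOp_cut_comp (b₁ := ScNorm' d L mv kk r hL ι) (liftBlk (scBlk' d L mv kk r hL) ι) (fun y y' => mul_nonneg (ind_nonneg _ _) (by positivity)) (S := cvSk d L mv kk hL k)
    (χ := fun p : ScX' d L mv kk r hL × ι => scChi' d L mv kk r hL k p.1) (fun p => abs_chiCube_le_one _ _)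
    (fun p hp => Finset.mem_coe.mpr (blockOf_mem_cubeBlocks_of_inner_ne_zero hM hm₁ hfitI hS0 hp)) h1
  rw [inv_inv, scCube', ← LinearMap.comp_assoc (mulOp fun p : ScX' d L mv kk r hL × ι => scPsi' d L mv kk r hL k p.1)]
  exact h2.mono fun y y' => le_of_eq (by ring)

end CutRows

end Summit.QuantumFields.YangMills.BalabanUVNodes.N15.Gluing

end
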